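import Mathlib
import HarnessLib
import HarnessLib.Audit
import Summits.AtomisticToContinuum.Statement
import Literature.Analysis.FluidPDE.HardSphereFlowConstruction
import Literature.Analysis.FluidPDE.VectorCalculus
import Literature.MathematicalPhysics.KineticTheory.HardSphereEulerProofs
import HarnessLib.Audit.Status.Attr

/-!
Route: BryanRoughSphereDial

DORMANT since 2026-08-23T05:27:24Z (reconciler: no traction for 5.9 d (last activity statement-checked at 2026-08-17T06:48:04Z); parked, not closed — `ledger route dormant route-AtomisticToContinuum-BryanRoughSphereDial --off` to reacti) — unstaffed, not closed; items shared with open routes are served there. `ledger route dormant <id> --off` reactivates.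

# Route BryanRoughSphereDial — Bryan's rough spheres as a Hamiltonian κ-dial onto hard spheres —
physical spin dice above the window, comparison below it

X = KappaSwapGap ∧ SmallKappaAccuracy ("it suffices to show"), realising card
bryan-rough-spheres-kappa-dial (spine). Replace the
conjunct's smooth spheres by BRYAN–PIDDUCK PERFECTLY ROUGH SPHERES (ChapmanCowling1970 §11.2): same
mass, diameter ε_N = σ(N+1)^(-1/3),
free flight and contacts as the library's collision-by-collision construction
(`Alexander.freeExitTime/incomingPairs`), each sphere carrying
a normalised spin s_i = √(I/m)ω_i ∈ ℝ³ (I = κmε²/4) and colliding by the rule that reverses the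
relative velocity of the contact points —
in normalised form (unit normal k, g = v_i − v_j, g_t its tangential part, S = s_i + s_j): impulse J
= −(g·k)k − κ(1+κ)⁻¹g_t −
√κ(1+κ)⁻¹ k×S on i (−J on j), spin kicks Δs_i = Δs_j = √κ(1+κ)⁻¹ k×g_t + (1+κ)⁻¹ k×(k×S); a linear
isometry of (v_i,v_j,s_i,s_j), an
involution, pair momentum and total energy exact, Liouville ⊗ Lebesgue(spins) invariant, statics
identical to the conjunct's; κ = 0 is
the specular rule (KappaZeroReduction). Along the dial κ_N = r(N+1)^(-1/3): KappaSwapGap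
(COMPARISON, the card's load-bearing conditional
R3) — pre-shock, from the same local Gibbs data (thermal spins at θ₀), the laws of the χ-tested
empirical density/momentum/translational-energy
fields of the deterministic hard-sphere flow and of the rough flow merge as N → ∞ then r → 0;
SmallKappaAccuracy (ENDPOINT) — the rough
gas's fields are within δ of every classical hs-Euler solution that stays a dilute fluid — the
conjunct's packing guard
ρ_t(x)σ³ < η₀ on [0,T) × 𝕋³ with ∃ η₀ > 0 outermost, carried verbatim since the conjunct's re-type
(2026-08-16, p126922) — for
r < r₀(δ) and N large. Then HydrodynamicLimit is Portmanteau plumbing, PROVED inside the crux-only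
deciding theorem `closes : KappaSwapGap → SmallKappaAccuracy →
_root_.HydrodynamicLimit` (D-0027 §2.1; route-repair 2026-08-16) onto `_root_.HydrodynamicLimit` by
name (this route re-files, conformingly, the items of
route-AtomisticToContinuum-RoughSpheresKappaDial, retired `not-a-thesis` by the 13:46Z audit only
because its assembly named the Literature constant instead of the sub-problem decl).
Above the window (κ_N(N+1)^(1/3) → ∞, incl. fixed κ) the spins are Olla–Varadhan–Yau-strength
conservative dice manufactured by rigid-body
mechanics and the limit is the γ = 4/3 Euler system (VanishingKappaEuler, RoughEulerFixedKappa —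
under the same packing guard): the route's
analogue theorems, where the
card's engine (SpinChaos ⇒ contact-Langevin reduction ⇒ ContactLangevinErgodicity, filed informally
after open) is provable-sized.
Lean: `KappaSwapGap ∧ SmallKappaAccuracy`

## Assembly
DECIDING THEOREM (D-0027 §2.1), CRUX-ONLY since the route-repair of 2026-08-16: `theorem closes :
KappaSwapGap → SmallKappaAccuracy →
_root_.HydrodynamicLimit` — hypotheses = the two load-bearing cruxes (X itself) and nothing else,
conclusion = the sub-problem Statement
decl `HydrodynamicLimit` BY NAME, and the DOCKING is PROVED inside the proof term (≈ 160 tactic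
lines, sorry-free, axioms propext /
Classical.choice / Quot.sound; the route imports
`Literature.MathematicalPhysics.KineticTheory.HardSphereEulerProofs` for
`isProbabilityMeasure_localGibbsLaw` (σ ≤ 1/2) and
`empirical{Density,Momentum,Energy}Field_eq_sum`). VanishingKappaEuler (crux, rank 5) is NOT a
hypothesis: it is the analogue rung the route wants proved, not an input to the conjunct (the cone
audit lists it, with the informal
LandauTellerWindow, as a crux outside the deciding theorem's cone — by design). The former support
item DockingGlue (KappaSwapGap ∧
SmallKappaAccuracy → HydrodynamicLimit) was DROPPED at the repair — its content is now the deciding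
theorem itself; the frame item Assembly
(KappaSwapGap → SmallKappaAccuracy → HydrodynamicLimit, = the type of `closes`) stays and is proved
by `closes` verbatim. The docking: take η₀ := the packing threshold SmallKappaAccuracy provides (the
conjunct's ∃ η₀ witness); fix
profiles, take σ₀ = min(σ₀^gap, σ₀^acc, 1/2) (σ ≤ 1/2 makes every P_N = localGibbsLaw a probability
measure); for σ < σ₀, a classical
solution on [0,T) obeying the guard ρ_tσ³ < η₀ (handed to SmallKappaAccuracy; KappaSwapGap, whose
conclusion never reads the solution,
stays unguarded and needs nothing), flows Φ, the t = 0 hypothesis (passed verbatim to both cruxes),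
t < T, continuous χ and δ > 0, let
c = ∫χρ_t and F(d,m,e) := min(1, (|d − c| − δ/2)₊) (1-Lipschitz for the sup metric, 0 ≤ F ≤ 1, F ≥
min(1,δ/2) on {δ < |d − c|}, F = 0
off {δ/2 < |d − c|}). For any η > 0 pick r < min(r₀^gap(F,η/2), r₀^acc(δ/2,η/2)) and N ≥ both N₀(r):
min(1,δ/2)·P_N(δ < |density
field(Φ_t z) − c|) ≤ ∫F∘fields∘Φ_t dP_N (Markov, `mul_meas_ge_le_lintegral₀`; the hard-sphere flow
maps are measurable) ≤
∫F∘fields_tr∘R_t d(P_N⊗γ) + η/2 (KappaSwapGap) ≤ (P_N⊗γ)(δ/2 < |density field(R_t) − c|) + η/2 (F ≤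
indicator,
`lintegral_indicator_one_le` — no measurability of the rough flow is needed: if F∘fields_tr∘R_t is
not P_N⊗γ-integrable its Bochner
integral is 0 and the step is free) ≤ η (SmallKappaAccuracy); η arbitrary ⇒ P_N(…) → 0
(`ENNReal.tendsto_nhds_zero`); likewise momentum
(F of ‖m − ∫χρ_t u_t‖) and energy (F of |e − ∫χE_t|): TendstoHydroFieldsAt at every t < T, i.e. the
body of the packing-guarded
conjunct `_root_.HydrodynamicLimit` with witness η₀ (re-typed 2026-08-16, p126922: verbatim
`HydroLimitInBandDim 3`,
`hydroLimitInBandDim_three_iff_root`; the former unguarded Literature statement still implies it,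
`HydrodynamicLimit.of_unguarded`).
VanishingKappaEuler, RoughEulerFixedKappa, RoughWellPosed, KappaZeroReduction and the informal
SpinChaos / ContactLangevinErgodicity /
LandauTellerWindow are the ladder ABOVE the endpoint, never hypotheses of `closes`.

Rationale: WHY THIS LINE. The only step of OllaVaradhanYau1993 that uses noise is the ergodic decomposition (§4
(B); FritzFunakiLebowitz1994, LiveraniOlla1996;
barrier MacroErgodicityBarrier), and four cards on the board manufacture "dice inside the collision"
artificially (AnosovRotorDice,
SpecularLambertianSwap, golf-ball, angular-noise); classical kinetic theory has owned a
deterministic, reversible, Newtonian version since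
Bryan 1894 / Pidduck1922 (ChapmanCowling1970 Ch. 11, CondiffLuDahler1965, MccoySandlerDahler1966,
CercignaniLampis1988; rigid-body
collisions as billiard-type maps CoxFeres2016): the spin of a perfectly rough sphere, Gaussian and
independent of everything under every
Gibbs state, kicked by O(1) at every contact and feeding back a tangential impulse of size √κ. The
planner's scaling check (NOTES.md;
ChapmanCowling1970 p. 202: "c small compared with σω but large compared with κσω") shows kick
VARIANCE and translational–rotational energy
DRIFT are both ≍ κ per collision, hence LOCKED along κ_N(N+1)^(1/3) → r: r → ∞ is exactly OVY's
weak-noise regime (dice per collision → 0,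
per unit time → ∞) but equipartition makes the limit the γ = 4/3 gas; r finite is the
two-temperature Euler–Landau–Teller window
(Widom1960 relaxation; ChapmanCowling1970 p. 207 footnote) with sub-OVY dice; r → 0 is the conjunct.
So the line imports stochastic
interacting-particle technology (relative entropy + FFL/LO classification, Lindeberg-CLT for the
accumulated √κ_N feedback) for the
analogue theorems ABOVE the window, and stochastic-stability / law-level comparison of two
deterministic chaotic flows (Kifer1990 class;
the contact-supported telescoping of SpecularLambertianSwap, MischlerMouhot2012) for the docking
BELOW it — stating honestly that the
endpoint item is conjunct-hard. What no open route does: a HAMILTONIAN comparison gas with the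
conjunct's own statics and phase-space
geometry whose distance to the specular flow is an explicit mechanical parameter (VanishingNoise:
external Markov noise; SpecularLambertianSwap:
Markov comparison gas at O(1) distance; SoftShoulderLandauDial: changes the statics;
AnosovRotorDice: designed rotors, Hopf machine).
Negatives index empty (2026-08-15).

RANKED CRUXES. #2 KappaSwapGap (crux) — COMPARISON / STOCHASTIC STABILITY (card R3, the load-bearing
conditional, layer-1 form; the loaded-sphere channel of card loaded-dice-jeans-spheres can attach by
restating with its flow). For continuous profiles ∃ σ₀ ∀ σ < σ₀, every classical hs-Euler solution
on [0,T), every family of hard-sphere flows Φ_N with local Gibbs laws P_N whose fields converge at t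
= 0: for every t < T, continuous χ, 1-Lipschitz F of the three χ-tested fields with |F| ≤ 1 and η >
0 there is r₀ > 0 such that for every r ∈ (0,r₀), for N ≥ N₀(r): |E_(P_N) F(fields(Φ_N,t z)) −
E_(P_N⊗γ) F(fields_tr(R^κ_N,t(z, √θ₀(x_i)ξ_i)))| ≤ η, κ_N = r(N+1)^(-1/3), R^κ the rough flow
(inline `let` block: rpair = Bryan's rule above on Cfg N × (Fin (N+1) → ℝ³), rstep = free flight to
`Alexander.freeExitTime` then rpair on the incoming contact pair, rstate/rinst/rflow its iteration
exactly as `Alexander.stateAfter/collisionInstant/fwdFlow`, spinLaw = `Measure.pi` of standard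
Gaussians, init = spins √θ₀(x_i)·ξ_i). [difficulty: open-problem] (why it might fail: the flows
decorrelate pathwise after O(1) collisions (Lyapunov rate ≍ N^(1/3)); law-level merging of the
fields is stochastic stability of hs-Euler statistics under O(√r·N^(-1/6)) contact kicks — unproved
for any chaotic N-body flow; an O(ρσ³) ring bias could survive r → 0.) [Kifer1990,
MischlerMouhot2012, OllaVaradhanYau1993, ChapmanCowling1970, doi:10.3934/krm.2018008]
#5 VanishingKappaEuler (crux) — THE OVY-REGIME ANALOGUE THEOREM — Euler for asymptotically smooth
rough spheres (sharpening of card rung R1 found by the scaling check). For every sequence κ_N > 0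
with κ_N → 0 and κ_N(N+1)^(1/3) → ∞ (tangential feedback per collision O(√κ_N) → 0, accumulated kick
variance and energy-exchange count per unit time ≍ κ_N(N+1)^(1/3) → ∞ — Olla–Varadhan–Yau's
weak-noise scaling realised by mechanics), all continuous profiles, ∃ σ₀ ∀ σ < σ₀: for every
classical solution on [0,T) of the γ = 4/3 hard-sphere Euler system (mass; momentum with p =
hsPressure σ ρ θ; energy with E = ρ(|u|²/2 + 3θ), written inline in the torus calculus) whose
packing fraction stays below a threshold (ρ_t(x)σ³ < η₀ on [0,T) × 𝕋³, ∃ η₀ > 0 outermost — the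
conjunct's guard, carried since the 2026-08-16 re-type: a dilute FLUID, where hsPressure is the
analytic virial EOS) and rough local Gibbs data (P_N ⊗ thermal spins at θ₀) whose translational
fields converge at t = 0, the empirical density, momentum and TRANSLATIONAL kinetic-energy fields of
the rough flow R^(κ_N) converge in probability at every t < T to ρ_t, ρ_t u_t and ρ_t(|u_t|²/2 +
3θ_t/2) (equipartition). [difficulty: open-problem] (why it might fail: needs SpinChaos in CLT form
(accumulated √κ_N k×(s_i+s_j) feedback = Gaussian contact noise given the translational past),
zero-friction ContactLangevinErgodicity, cubic tails (HighMomentumCutoff) and fast equipartition;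
ring-correlated spins at positive ρσ³ may bias the dice.) [OllaVaradhanYau1993,
FritzFunakiLebowitz1994, LiveraniOlla1996, ChapmanCowling1970, OdellBerne1975, CondiffLuDahler1965]
#6 SmallKappaAccuracy (crux) — ENDPOINT RUNG (card R3's second half, accuracy form — the
Euler–Landau–Teller window read at small r through continuous dependence of classical relaxation
solutions on r, so no new PDE notion is needed). Same frame as KappaSwapGap plus the conjunct's
packing guard (∃ η₀ > 0 outermost; hypothesis ρ_t(x)σ³ < η₀ on [0,T) × 𝕋³ before ∀ Φ, token for
token the re-typed `_root_.HydrodynamicLimit`, p126922); conclusion: for every t < T, continuous χ,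
δ > 0 and η > 0 there is r₀ > 0 such that for r ∈ (0,r₀) and N ≥ N₀(r), under P_N ⊗ γ the
probability that the χ-tested empirical density (resp. momentum, translational energy) field of
R^(κ_N)_t, κ_N = r(N+1)^(-1/3), deviates by more than δ from ∫χρ_t (resp. ∫χρ_t u_t, ∫χE_t with E =
ρ(|u|²/2 + 3θ/2), the CONJUNCT's guarded hs-Euler solution) is ≤ η. [difficulty: open-problem] (why
it might fail: at κ_N = r(N+1)^(-1/3) the spin dice are sub-OVY (kick variance O(r) per particle per
unit time, zero microscopic rate): neither FFL/LO nor OVY's Dirichlet-form step applies, the ergodic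
input must come from the deterministic collisions — conjunct-hard at small r.) [OllaVaradhanYau1993,
Widom1960, ChenLevermoreLiu1994, ChapmanCowling1970,
Literature.Barriers.AtomisticToContinuum.MacroErgodicityBarrier]
#9 RoughEulerFixedKappa (support) — ANALOGUE THEOREM AT FIXED ROUGHNESS (card rung R1; support — it
does not drive staffing, VanishingKappaEuler does): for every κ ∈ (0, 2/3] and continuous profiles ∃
σ₀ ∀ σ < σ₀: γ = 4/3 hard-sphere Euler (inline clauses and packing guard as in VanishingKappaEuler)
from the deterministic rough-sphere flow R^κ with rough local Gibbs data, pre-shock, convergence in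
probability of density, momentum and translational-energy fields (the latter to ρ(|u|²/2 + 3θ/2)).
Expected proof: SpinChaos (fixed-κ form) ⇒ contact-Langevin reduction ⇒ ContactLangevinErgodicity ⇒
OVY §4 (C)–(E) + relative-entropy bookkeeping with contact currents, EOS from the conjunct's statics
(VirialEosIdentification 0782, LocalGibbsConcentration 0767 apply verbatim: same excluded volume).
[difficulty: open-problem] [ChapmanCowling1970, CondiffLuDahler1965, OllaVaradhanYau1993,
FritzFunakiLebowitz1994, CoxFeres2016]
#9 RoughWellPosed (support) — ALEXANDER'S THEOREM FOR THE ROUGH FLOW (every κ ≥ 0, 0 < σ < 1/2,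
every N): (a) p ↦ R^κ_t p is measurable for each t; (b) for Liouville ⊗ Lebesgue-a.e. (z, s) every
finite exit configuration of the rough recursion is a simple incoming collision, no pair touches
strictly inside a free flight, and the exit times sum to ∞ (the three `FwdGood` clauses for rstate);
(c) R^κ_t preserves Liouville ⊗ Lebesgue(spins) for t ≥ 0. Same proof as `torusFlow_ae_good_holds` /
`torusFlow_measurePreserving_holds` (CIP1994 App. 4.A): the rule is a linear isometry of
(v_i,v_j,s_i,s_j) reversing g·k, so it maps the incoming flux measure |g·k| dS dv ds onto the
outgoing one; note the map is DIScontinuous at grazing (ChapmanCowling1970 §11.8), which the measure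
argument does not mind. [difficulty: M] [CIP1994, GST2013, ChapmanCowling1970, CoxFeres2016]
#9 KappaZeroReduction (support) — UNIT TEST OF THE DIAL'S ENDPOINT (provable now, by unfolding and
induction on the collision index): at κ = 0 the typed rule is J = −(g·k)k = `collidePair` on the
translational variables and the spin update does not feed back, so the translational projection of
R^0 is the library's `Alexander.fwdFlow` for every σ, N, initial (z, s) and t (same branching on
`freeExitTime = ⊤` / `incomingPairs`, same `Set.Nonempty.some`). [difficulty: provable-now]
[CIP1994, ChapmanCowling1970]

TWO-LAYER PLAN. Foreseen glued splits (k ≤ 3, depth 1), nothing filed now. VanishingKappaEuler ⇐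
SpinChaosCLT (SpinChaos (b), typed once D1 lands) →
ZeroFrictionContactErgodicity (ContactLangevinErgodicity, γ → 0 form, typed once D2–D3 land) →
OVYBookkeepingRough (relative entropy with
contact currents, conjunct's EOS, cubic tails = EnergyCurrentTails 3655 restated for R^κ) →
VanishingKappaEuler. SmallKappaAccuracy ⇐
LandauTellerWindow (all r ∈ (0,r₁)) → RelaxationContinuity (classical Euler–Landau–Teller solutions
with well-prepared data θ_rot = θ_tr
depend continuously on r at r = 0 on [0,t], ChenLevermoreLiu1994 structure; PDE, provable with a
local well-posedness theory) →
SmallKappaAccuracy. KappaSwapGap ⇐ RoughSwapIdentity (the contact-supported telescoping identity of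
SpecularLambertianSwap's SwapIdentity
with the rough continuation in place of the Lambertian one — both gases share free flight and exit
times given the translational state, so
it is again exact) → RoughLinearResponse (influence of one O(√κ_N) tangential kick on the future
tested fields is O(√κ_N·N^(-1)) in mean,
summable against ≍ σ²N^(4/3) contacts only after averaging the sign of k×S: a martingale, not a
Gronwall, structure) → KappaSwapGap.

KILL CRITERIA. (1) ¬KappaSwapGap — e.g. event-driven MD showing the block-field gap between HS and
rough spheres at κ = rN^(-1/3) from identical local-Gibbs
samples NOT decreasing as r ↓ 0 at fixed large N, or a proof that an O(ρσ³) field bias survives —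
closes the route `refuted:KappaSwapGap`
and retires the docking of every Hamiltonian-dial card (loaded-dice, golf-ball, soft-shoulder,
einstein-bath) with the same witness.
(2) ¬VanishingKappaEuler with SpinChaos intact (a non-Gibbs regular stationary state of the infinite
hard-sphere flow invariant under
Gaussian tangential contact kicks) refutes ContactLangevinErgodicity's zero-friction form: pivot the
analogue rung to fixed κ
(RoughEulerFixedKappa) or close `refuted:VanishingKappaEuler` if that dies too. (3) ¬SpinChaos at
fixed κ (persistent O(1) spin–velocity
correlation of colliding pairs out of equilibrium, OdellBerne1975-type) demotes the card's engine;
the route survives on KappaSwapGap +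
SmallKappaAccuracy only if (1) stands — else close. (4) ¬SmallKappaAccuracy refutes, through
KappaSwapGap, the conjunct itself (hand the
witness to the negatives index). Mooted: HydrodynamicLimit proved by any entropy route moots
SmallKappaAccuracy's role but leaves
KappaSwapGap / VanishingKappaEuler independently wanted; GibbsErgodicity (0779) proved makes
ContactLangevinErgodicity a corollary. (5) Out of
scope since the 2026-08-16 re-type (route-repair, p126922): the implosion / dense-excursion
programme against the old σ₀-before-T prefix
(ImplosionDichotomy's DenseExcursion, audit §3.1) bears on no item here — SmallKappaAccuracy,
VanishingKappaEuler and RoughEulerFixedKappa carry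
the conjunct's packing guard, and KappaSwapGap's conclusion never reads the Euler solution.

NOT DECOMPOSED YET. SpinChaos (rank 3) and ContactLangevinErgodicity (rank 4) are filed INFORMAL
right after open (they need D1–D3) and typed by
set-signature when the definitions land; LandauTellerWindow (support, informal; needs D4) likewise.
Not decomposed: the exchange
coefficient c(ρσ³, θ) of the window system (κ → 0 limit of κ⁻¹ × the Pidduck/Widom/Condiff–Lu–Dahler
relaxation frequency times the
contact value Y(ρσ³)); velocity/spin tail truncations (EnergyCurrentTails 3655 restated for R^κ,
plus the rotational current
v|s|²/2 of the same cubic type); the equipartition layer (θ_rot → θ_tr on times ≍ (κ_N N^(1/3))⁻¹);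
the contact-current form of the
virial EOS for rough collisions (normal impulse unchanged ⇒ same hsPressure; tangential impulses
average out — to be checked in
OVYBookkeepingRough); the N + 1 = 2 unit test of RoughSwapIdentity; smooth-vs-continuous χ
approximations (layer-2 support).

CHEAPEST FALSIFIER. (i) ALGEBRA, done here (pure python, NOTES.md): the normalised rule conserves
Σ|v|²+|s|² and momentum exactly, reverses the contact
velocity, is an involution, is specular at κ = 0, and gives tangential velocity kicks
1.20/0.23/0.004 thermal units at κ = 0.4/0.05/10⁻⁴
(≍ √κ) with O(1) spin kicks — the locking of dice strength and energy exchange that shapes the route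
(consistency check, not a kill).
(ii) Decisive cheap experiment (kit, not run here): event-driven MD of elastic rough spheres, φ =
0.05–0.1, N = 10³–10⁵: (a) block-field
gap HS vs rough at κ = rN^(-1/3) from identical local-Gibbs samples (shear + temperature wave)
versus r and N — must decrease as r ↓ 0
uniformly in N (KappaSwapGap); (b) T_tr − T_rot relaxation time versus κN^(1/3) — crossover at κ ≍
Kn (window); (c) spin–velocity and
partner-spin correlations of colliding pairs under uniform shear at fixed κ — an O(1),
Kn-independent correlation kills SpinChaos
(OdellBerne1975 saw molecular-chaos deviations only at liquid densities). (iii) Lookup done: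
ChapmanCowling1970 §11.8 — rough collisions
are discontinuous at grazing; harmless for RoughWellPosed (measure argument), relevant to any
standard-pair use.

NUMBERS. Fixed reduced density (N+1)ε³ = σ³; ≍ σ²(N+1)^(1/3) collisions per sphere per unit time.
Bryan's rule (ChapmanCowling1970 11.2 (1)–(10)),
κ = 4I/mε² ∈ (0, 2/3] (2/5 uniform ball, 2/3 shell). Per collision with thermal spins: tangential
velocity kick ≍ √κ·v_th, translational
energy change ≍ √κ·θ (random sign), systematic T_tr–T_rot exchange ≍ κ(θ_tr − θ_rot), spin kick
O(1): kick variance rate = exchange rate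
≍ κ_N σ²(N+1)^(1/3) =: r·σ². Regimes: r → ∞ ⇒ one temperature, e = 3θ, γ = 4/3 (ChapmanCowling1970
p. 207); r → 0 ⇒ γ = 5/3 + passive
spins; r ∈ (0,∞) ⇒ Euler–Landau–Teller. OVY's noise: intensity θ(ε) → ∞ with εθ(ε) → 0
(OllaVaradhanYau1993 §2.1) ⇔ here κ_N → 0 with
κ_N N^(1/3) → ∞ (VanishingKappaEuler). Rough-vs-smooth first-approximation conductivity ratio 1.480
at κ → 0 (ChapmanCowling1970 p. 214:
the limits κ → 0 and Kn → 0 do not commute). Items at open: 8 (3 typed cruxes + 4 typed supports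
incl. DockingGlue + assembly); after the informal adds (SpinChaos r3, ContactLangevinErgodicity r4,
LandauTellerWindow r9): 11. Route-repair 2026-08-16 (statement re-type
hydro2, p126922): SmallKappaAccuracy, VanishingKappaEuler, RoughEulerFixedKappa restated 1:1 with
the guard — each implied by its rev-3 form
with η₀ := 1 (Sketch.lean `…_of_unguarded`, rc 0) — the let telescope untouched
(RoughSphereFlowInline's rw-bridge still applies); `closes`
then made CRUX-ONLY (human ruling 2026-08-16, `glue.non-crux-hypothesis`): `closes : KappaSwapGap →
SmallKappaAccuracy → _root_.HydrodynamicLimit`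
with the docking PROVED inline (import HardSphereEulerProofs added); DockingGlue (stmt-9279) dropped
as absorbed, Assembly (stmt-9280, = the type of
`closes`) kept — 10 items remain (typed cruxes KappaSwapGap r2 / VanishingKappaEuler r5 /
SmallKappaAccuracy r6, informal auto-crux LandauTellerWindow
r9, Assembly r1, typed supports RoughWellPosed / RoughEulerFixedKappa / KappaZeroReduction, informal
SpinChaos r3 / ContactLangevinErgodicity r4).

DEFINITION REQUESTS. D1 `RoughSphereFlow` API (topic
Summits/AtomisticToContinuum/HydrodynamicLimit/Theorems; new object posited for this problem): named
definitions `roughPair κ`, `roughStep`, `roughStateAfter`, `roughInstant`, `roughFlow`, `spinLaw`,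
`roughInit` — verbatim the `let` block
of KappaSwapGap — plus the empirical collision/spin measures needed to type SpinChaos;
existence/measure preservation is the separate
support RoughWellPosed (never smuggled into the interface). D2 `ContactLangevinGas` (same topic):
the Markov hard-sphere dynamics with the
spin-marginalised Bryan rule (J = −(g·k)k − κ(1+κ)⁻¹g_t − √κ(1+κ)⁻¹ k×Σ, Σ ~ N(0, 2θ_b·Id) fresh at
each contact), finite N on 𝕋³ by the
ξ-driven collision recursion (as SpecularLambertianSwap's Lambertian API) and infinite volume via
D3. D3 `RegularStationaryState` (topic
Literature/MathematicalPhysics/KineticTheory): translation-invariant stationary states of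
Alexander's a.s. infinite-volume (marked)
hard-sphere dynamics with finite density/energy and specific entropy — the same request as
AnosovRotorDice's D3 and GibbsErgodicity 0779.
D4 `IsLandauTellerEulerSolution σ r T ρ u θ_tr θ_rot` (topic
Literature/MathematicalPhysics/KineticTheory): classical solutions of the
two-temperature Euler system with relaxation source, to type LandauTellerWindow. No cite facts
needed.

Novelty: Searches (2026-08-15): `lit frontier AtomisticToContinuum --since 2020` (30 rows; only deterministic
macroscopic limit:
CanestrariLiveraniOlla2026 = arXiv:2310.13338, diffusive); `lit bridges AtomisticToContinuum --cross
any` (30 rows, nothing on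
internal-state gases); `lit search --source crossref` ×5 — "rough spheres kinetic theory rotational
translational temperature relaxation
hydrodynamics" (12: HuthmannZippelius1997, Widom1960, doi:10.1515/jnet.1986.11.3-4.145,
granular/inelastic rest), "rough sphere gas Enskog
hydrodynamic equations … Kremer Santos" (12: doi:10.1007/s10955-024-03269-w inelastic rough Maxwell,
doi:10.1063/1.441099), "rough hard
sphere fluid molecular dynamics spin velocity correlation Berne" (10: OdellBerne1975,
PangaliBerne1977, doi:10.1063/1.434355), "zero noise
limit hydrodynamic limit Hamiltonian small stochastic perturbation" (10, nothing relevant),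
"Landau-Teller relaxation two-temperature Euler
relaxation limit" (10: doi:10.1007/s00030-012-0159-0, doi:10.1016/j.jde.2015.11.034 — PDE relaxation
limits only); `lit galaxy search
"perfectly rough spheres" --star all` (9 panama: Hirschfelder–Curtiss–Bird, Ferziger–Kaper, CC; pdf:
Kremer's Boltzmann book) and
`"rough spherical molecules" --star all` (6 panama incl. both CC editions, Cercignani CISM 293; 2
pdf); `lit read` ChapmanCowling1970
pp. 199–218 (held; §11.2 rule, κ → 0 remark, γ = 4/3, §11.8); local `lit search --hybrid` down this
session (searchd exit 75, logged).
Plus the card's two refuter a  [refs: 10.1515/jnet.1986.11.3-4.145, 10.1007/s10955-024-03269-w, 10.1063/1.441099, 10.1063/1.434355, 10.1007/s00030-012-0159-0, 10.1016/j.jde.2015.11.034, 2310.13338, doi:10.1515/jnet.1986.11.3-4.145, doi:10.1007/s10955-024-03269-w, doi:10.1063/1.441099, doi:10.1063/1.434355, doi:10.1007/s00030-012-0159-0, doi:10.1016/j.jde.2015.11.034, CanestrariLiveraniOlla2026, HuthmannZippelius1997, Widom1960, OdellB]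

Barriers (technique_class: hamiltonian-dial internal-dof rel-entropy stoch-stability): - technique_class: hamiltonian-dial internal-dof rel-entropy stoch-stability
- Literature.Barriers.AtomisticToContinuum.BoltzmannHypothesisBarrier: for the analogue rungs
(VanishingKappaEuler, RoughEulerFixedKappa) the classification input is REPLACED, given SpinChaos,
by invariance under a conservative contact noise (the catalogue's own evasion "add conservative
noise", realised by mechanics); for the conjunct nothing is evaded — SmallKappaAccuracy carries the
weight and says so. Kernel respected: with no collisions the spins are never read, the rough and
smooth free flights coincide, KappaSwapGap holds trivially and SmallKappaAccuracy fails, correctly.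
- Literature.Barriers.AtomisticToContinuum.BoltzmannHypothesisBarrierNarrow: same slot; the
flux-level closure for the rough gas is what OVYBookkeepingRough must supply from the contact-noise
invariance, not assumed.
- Literature.Barriers.AtomisticToContinuum.MacroErgodicityBarrier: its evasion (a) is
ContactLangevinErgodicity's class; conceded that FFL's printed scope (bounded V″) does not cover
hard cores and that the noise is contact-supported (shared with SpecularLambertianSwap's
LambertianEuler); below the window it is not evaded (the bet is named: SmallKappaAccuracy).
- Literature.Barriers.AtomisticToContinuum.HighMomentumCutoffBarrier: it does not evade it; cubic
translational AND rotational energy currents need the same uniform integrability (EnergyCurrentTails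
3655 restated) — flagged in VanishingKappaEuler's why-lin

Novelty grade: new-combination — route-review g5 (refuter rreview-0815T13-6-g5-0), problem-relative standard. Levers: (i) OVY's vanishing conservative collision-level noise for Euler [OVY1993] realised by a PHYSICAL internal dof — Bryan/Pidduck rough spheres [CC1970 §11.2; CondiffLuDahler1965; McCoySandlerDahler1966; CercignaniLamp (refuter refuter-rreview-0815T13-6-g5-0, 2026-08-15T22:34:32Z; prior: OllaVaradhanYau1993, ChapmanCowling1970 §11.2, doi:10.1063/1.1695749, doi:10.1063/1.1727365, doi:10.1007/bf01014218, Kifer1990, route-AtomisticToContinuum-VanishingNoise (stmt-AtomisticToContinuum-0812), route-AtomisticToContinuum-SpecularLambertianSwap, route-AtomisticToContinuum-AnosovRotorDice, arXiv:1612.03355, doi:10.1103/physreve.80.016206)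

History (route lifecycle, newest last):
- 2026-08-15T16:33:24Z · rev 2: restated RoughWellPosed (stmt-AtomisticToContinuum-9277) — cone repair (route-repair g2): restate support RoughWellPosed with Alexander.IsSimpleIncoming inlined (cite-tagged predicate, no _holds possible, not statement (planner-rrepair-AtomisticToContinuum-BryanRoug-08946d8d-g2-0)
- 2026-08-16T02:18:46Z · AUTO-CRUX: 1 conjecture-grade item(s) promoted to crux (LandauTellerWindow) — refuter vetting / tiering apply (operator:999:1362873)
- 2026-08-16T23:16:58Z · rev 4: restated SmallKappaAccuracy (stmt-AtomisticToContinuum-9275) — route-repair (statement-revised, retype hydro2 p126922): restate crux SmallKappaAccuracy 1:1 with the conjunct's packing guard token-for-token (∃ η₀ > 0 outermo (planner-rrepair-AtomisticToContinuum-BryanRoug-60347806-0)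
- 2026-08-16T23:36:45Z · rev 5: dropped DockingGlue — route-repair (crux-only, human ruling 2026-08-16 / glue.non-crux-hypothesis): deciding theorem made CRUX-ONLY — `closes : KappaSwapGap → SmallKappaAccuracy → _r (planner-rrepair-AtomisticToContinuum-BryanRoug-60347806-0)
- 2026-08-16T23:37:21Z · rev 6: restated VanishingKappaEuler (stmt-AtomisticToContinuum-9274), RoughEulerFixedKappa (stmt-AtomisticToContinuum-9276) — route-repair (statement-revised p126922, hygiene): restate the two ANALOGUE rungs VanishingKappaEuler (crux r5, outside the closes cone) and RoughEulerFixedKapp (planner-rrepair-AtomisticToContinuum-BryanRoug-60347806-0)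
- 2026-08-23T05:27:24Z · DORMANT — reconciler: no traction for 5.9 d (last activity statement-checked at 2026-08-17T06:48:04Z); parked, not closed — `ledger route dormant route-AtomisticToContinu (operator:999:221138)

sub-problem: HydrodynamicLimit · status: dormant · opened planner-plancard-AtomisticToContinuum-Hydrody-24247dcf-0 2026-08-15T13:54:58Z · rev 6 · ledger route-AtomisticToContinuum-BryanRoughSphereDial
GENERATED by the gate from the ledger (D-0016/17). Provers cite these decls: `theorem foo : Summit.AtomisticToContinuum.HydrodynamicLimit.Theses.BryanRoughSphereDial.<Decl> := …` in Summits/AtomisticToContinuum/HydrodynamicLimit/Theorems/<Name>.lean.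
-/

namespace Summit.AtomisticToContinuum.HydrodynamicLimit.Theses.BryanRoughSphereDial

open scoped BigOperators Topology Manifold Classical MeasureTheory ProbabilityTheory Matrix InnerProductSpace ComplexConjugate ContinuousMap
open Filter Set Function TopologicalSpace MeasureTheory

attribute [summit_statement] _root_.HydrodynamicLimit

/-- item stmt-AtomisticToContinuum-9273 · crux · rank 2 · open · by planner
why it might fail: Paths decorrelate after O(1) collisions (Lyapunov ≍ N^(1/3)); merging of field LAWS, N → ∞ before r → 0, is stochastic stability of a singular chaotic N-body flow under O(√r·N^(-1/6)) contact kicks — in print only for hyperbolic diffeos and 1-particle 2-D billiards; an O(ρσ³) bias may stay.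
sources: Kifer1990, doi:10.1017/s0143385704000604, arXiv:1210.1261, OllaVaradhanYau1993, ChapmanCowling1970, MischlerMouhot2012
[crux] COMPARISON / STOCHASTIC STABILITY (card R3, the load-bearing conditional, layer-1 form; the
loaded-sphere channel of card loaded-dice-jeans-spheres can attach by restating with its flow). For
continuous profiles ∃ σ₀ ∀ σ < σ₀, every classical hs-Euler solution on [0,T), every family of
hard-sphere flows Φ_N with local Gibbs laws P_N whose fields converge at t = 0: for every t < T,
continuous χ, 1-Lipschitz F of the three χ-tested fields with |F| ≤ 1 and η > 0 there is r₀ > 0 such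
that for every r ∈ (0,r₀), for N ≥ N₀(r): |E_(P_N) F(fields(Φ_N,t z)) − E_(P_N⊗γ)
F(fields_tr(R^κ_N,t(z, √θ₀(x_i)ξ_i)))| ≤ η, κ_N = r(N+1)^(-1/3), R^κ the rough flow (inline `let`
block: rpair = Bryan's rule above on Cfg N × (Fin (N+1) → ℝ³), rstep = free flight to
`Alexander.freeExitTime` then rpair on the incoming contact pair, rstate/rinst/rflow its iteration
exactly as `Alexander.stateAfter/collisionInstant/fwdFlow`, spinLaw = `Measure.pi` of standard
Gaussians, init = spins √θ₀(x_i)·ξ_i). [difficulty: open-problem] -/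
@[route_item "route-AtomisticToContinuum-BryanRoughSphereDial", crux]
def KappaSwapGap : Prop :=
  open MeasureTheory Filter ProbabilityTheory Literature.Analysis.FluidPDE Literature.MathematicalPhysics.KineticTheory Literature.Analysis.FunctionSpaces in let Cfg : ℕ → Type := fun N => Config (N + 1) (Fin 3) T3; let Spin : ℕ → Type := fun N => Fin (N + 1) → V3; let G := Torus.geometry (Fin 3); let ε : ℝ → ℕ → ℝ := hsDiameter; let τ : ℝ → (N : ℕ) → Cfg N → ENNReal := fun σ N z => Alexander.freeExitTime G (ε σ N) z; let S : ℝ → (N : ℕ) → Cfg N → Cfg N := fun t _ z => freeFlight G t z; let rpair : ℝ → (N : ℕ) → Fin (N + 1) → Fin (N + 1) → Cfg N × Spin N → Cfg N × Spin N := fun κ _ i j p => let z := p.1; let s := p.2; let n := G.sepVec (z i).1 (z j).1; let k := ‖n‖⁻¹ • n; let g := (z i).2 - (z j).2; let gt := g - (⟪g, k⟫_ℝ) • k; let S2 := s i + s j; let J := -((⟪g, k⟫_ℝ) • k) - (κ / (1 + κ)) • gt - (Real.sqrt κ / (1 + κ)) • cross k S2; let ds := (Real.sqrt κ / (1 + κ))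 • cross k gt + (1 / (1 + κ)) • cross k (cross k S2); (Function.update (Function.update z i ((z i).1, (z i).2 + J)) j ((z j).1, (z j).2 - J), Function.update (Function.update s i (s i + ds)) j (s j + ds)); let rstep : ℝ → ℝ → (N : ℕ) → Cfg N × Spin N → Cfg N × Spin N := fun κ σ N p => let z' := S (τ σ N p.1).toReal N p.1; if τ σ N p.1 = ⊤ then p else if h : (Alexander.incomingPairs G (ε σ N) z').Nonempty then rpair κ N h.some.1 h.some.2 (z', p.2) else (z', p.2); let rstate : ℝ → ℝ → (N : ℕ) → Cfg N × Spin N → ℕ → Cfg N × Spin N := fun κ σ N p k => (rstep κ σ N)^[k] p; let rinst : ℝ → ℝ → (N : ℕ) → Cfg N × Spin N → ℕ → ENNReal := fun κ σ N p k => ∑ m ∈ Finset.range k, τ σ N (rstate κ σ N p m).1; let rflow : ℝ → ℝ → (N : ℕ) → Cfg N × Spin N → ℝ → Cfg N × Spin N := fun κ σ N p t => let K := sSup {k : ℕ | rinst κ σ N p k ≤ ENNReal.ofReal t}; (S (t - (rinst κ σ N p K).toReal) N (rstate κ σ N p K).1, (rstate κ σ N p K).2); let spinLaw : (N : ℕ)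 → Measure (Spin N) := fun N => Measure.pi (fun _ : Fin (N + 1) => stdGaussian V3); let init : (T3 → ℝ) → (N : ℕ) → Cfg N × Spin N → Cfg N × Spin N := fun θ₀ _ p => (p.1, fun i => Real.sqrt (θ₀ (p.1 i).1) • p.2 i); let fld : (N : ℕ) → Cfg N → (T3 → ℝ) → ℝ × V3 × ℝ := fun _ z χ => (empiricalDensityField z χ, empiricalMomentumField z χ, empiricalEnergyField z χ); ∀ (a₀ θ₀ : T3 → ℝ) (u₀ : T3 → V3), Continuous a₀ → Continuous θ₀ → Continuous u₀ → (∀ x, 0 < a₀ x) → (∀ x, 0 < θ₀ x) → ∃ σ₀ : ℝ, 0 < σ₀ ∧ ∀ σ : ℝ, 0 < σ → σ < σ₀ → ∀ (T : ℝ) (ρ θ : ℝ → T3 → ℝ) (u : ℝ → T3 → V3), IsHardSphereEulerSolution σ T ρ u θ → ∀ Φ : (N : ℕ) → HardSphereFlow G (ε σ N) (N + 1), let P := fun N => localGibbsLaw σ a₀ u₀ θ₀ N (Φ N); TendstoHydroFieldsAt P Φ ρ u θ 0 → ∀ t ∈ Set.Ico 0 T, ∀ χ : T3 → ℝ, Continuous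 χ → ∀ F : ℝ × V3 × ℝ → ℝ, LipschitzWith 1 F → (∀ y, |F y| ≤ 1) → ∀ η : ℝ, 0 < η → ∃ r₀ : ℝ, 0 < r₀ ∧ ∀ r : ℝ, 0 < r → r < r₀ → ∃ N₀ : ℕ, ∀ N : ℕ, N₀ ≤ N → |(∫ z, F (fld N ((Φ N).flow t z) χ) ∂(P N)) - ∫ p, F (fld N (rflow (r * ((N : ℝ) + 1) ^ (-(1 / 3 : ℝ))) σ N (init θ₀ N p) t).1 χ) ∂((P N).prod (spinLaw N))| ≤ η

-- earlier VanishingKappaEuler (stmt-AtomisticToContinuum-9274, replaced 2026-08-16T23:37:21Z -> stmt-AtomisticToContinuum-17783): retired by None — open MeasureTheory Filter ProbabilityTheory Literature.Analysis.FluidPDE Literature.MathematicalPhysics.KineticTheory Literature.Analysis.FunctionSpaces in let Cfg : ℕ → Type := fun N => Config (N + 1) (Fin 3) T3; let Spin : ℕ → Type := fun N => Fin (N +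
/-- item stmt-AtomisticToContinuum-17783 · crux · rank 5 · open · by planner
why it might fail: Even with genuine noise OVY needs a non-quadratic bounded-gradient KE, and FFL/LO ergodicity is printed for smooth bounded-V″ potentials with bulk noise; here KE is quadratic (cubic current tails), cores hard, noise contact-supported and only derived from deterministic spins (SpinChaos-CLT, rings).
sources: OllaVaradhanYau1993, FritzFunakiLebowitz1994, LiveraniOlla1996, Literature.Barriers.AtomisticToContinuum.HighMomentumCutoffBarrier, Literature.Barriers.AtomisticToContinuum.MacroErgodicityBarrier, OdellBerne1975
[crux] THE OVY-REGIME ANALOGUE THEOREM, PACKING-GUARDED — Euler for asymptotically smooth rough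
spheres (sharpening of card rung R1 found by the scaling check). ∃ η₀ > 0 (packing threshold,
outermost — the conjunct's guard carried since the 2026-08-16 re-type, p126922; the rev-3 unguarded
form implies this one with η₀ := 1, `VanishingKappaEuler_of_unguarded` in Sketch.lean) such that for
every sequence κ_N > 0 with κ_N → 0 and κ_N(N+1)^(1/3) → ∞ (tangential feedback per collision
O(√κ_N) → 0, accumulated kick variance and energy-exchange count per unit time ≍ κ_N(N+1)^(1/3) → ∞
— Olla–Varadhan–Yau's weak-noise scaling realised by mechanics), all continuous profiles, ∃ σ₀ ∀ σ <
σ₀: for every classical solution on [0,T) of the γ = 4/3 hard-sphere Euler system (mass; momentum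
with p = hsPressure σ ρ θ; energy with E = ρ(|u|²/2 + 3θ), written inline in the torus calculus)
whose packing fraction obeys ρ_t(x)σ³ < η₀ on [0,T) × 𝕋³ (dilute fluid: hsPressure on its analytic
virial branch, no implosion / close-packing excursion in scope), and rough local Gibbs data (P_N ⊗
thermal spins at θ₀) whose translational fields converge at t = 0, the empirical density, momentum
and TRANSLATIONAL kine -/
@[route_item "route-AtomisticToContinuum-BryanRoughSphereDial"]
def VanishingKappaEuler : Prop :=
  open MeasureTheory Filter ProbabilityTheory Literature.Analysis.FluidPDE Literature.MathematicalPhysics.KineticTheory Literature.Analysis.FunctionSpaces in let Cfg : ℕ → Type := fun N => Config (N + 1) (Fin 3) T3; let Spin : ℕ → Type := fun N => Fin (N + 1) → V3; let G := Torus.geometry (Fin 3); let ε : ℝ → ℕ → ℝ := hsDiameter; let τ : ℝ → (N : ℕ) → Cfg N → ENNReal := fun σ N z => Alexander.freeExitTime G (ε σ N) z; let S : ℝ → (N : ℕ) → Cfg N → Cfg N := fun t _ z => freeFlight G t z; let rpair : ℝ → (N : ℕ) → Fin (N + 1) → Fin (N + 1) → Cfg N × Spin N → Cfg N × Spin N :=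 fun κ _ i j p => let z := p.1; let s := p.2; let n := G.sepVec (z i).1 (z j).1; let k := ‖n‖⁻¹ • n; let g := (z i).2 - (z j).2; let gt := g - (⟪g, k⟫_ℝ) • k; let S2 := s i + s j; let J := -((⟪g, k⟫_ℝ) • k) - (κ / (1 + κ)) • gt - (Real.sqrt κ / (1 + κ)) • cross k S2; let ds := (Real.sqrt κ / (1 + κ)) • cross k gt + (1 / (1 + κ)) • cross k (cross k S2); (Function.update (Function.update z i ((z i).1, (z i).2 + J)) j ((z j).1, (z j).2 - J), Function.update (Function.update s i (s i + ds)) j (s j + ds)); let rstep : ℝ → ℝ → (N : ℕ) → Cfg N × Spin N → Cfg N × Spin N := fun κ σ N p => let z' := S (τ σ N p.1).toReal N p.1; if τ σ N p.1 = ⊤ then p else if h : (Alexander.incomingPairs G (ε σ N) z').Nonempty then rpair κ N h.some.1 h.some.2 (z', p.2) else (z', p.2); let rstate : ℝ → ℝ → (N : ℕ) → Cfg N × Spin N → ℕ → Cfg N × Spin N := fun κ σ N p k => (rstep κ σ N)^[k] p; let rinst : ℝ → ℝ → (N : ℕ) → Cfg N × Spin N → ℕ → ENNReal := fun κ σ N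 p k => ∑ m ∈ Finset.range k, τ σ N (rstate κ σ N p m).1; let rflow : ℝ → ℝ → (N : ℕ) → Cfg N × Spin N → ℝ → Cfg N × Spin N := fun κ σ N p t => let K := sSup {k : ℕ | rinst κ σ N p k ≤ ENNReal.ofReal t}; (S (t - (rinst κ σ N p K).toReal) N (rstate κ σ N p K).1, (rstate κ σ N p K).2); let spinLaw : (N : ℕ) → Measure (Spin N) := fun N => Measure.pi (fun _ : Fin (N + 1) => stdGaussian V3); let init : (T3 → ℝ) → (N : ℕ) → Cfg N × Spin N → Cfg N × Spin N := fun θ₀ _ p => (p.1, fun i => Real.sqrt (θ₀ (p.1 i).1) • p.2 i); ∃ η₀ : ℝ, 0 < η₀ ∧ ∀ κs : ℕ → ℝ, (∀ N, 0 < κs N) → Tendsto κs atTop (nhds 0) → Tendsto (fun N : ℕ => κs N * ((N : ℝ) + 1) ^ (1 / 3 : ℝ)) atTop atTop → ∀ (a₀ θ₀ : T3 → ℝ) (u₀ : T3 → V3), Continuous a₀ → Continuous θ₀ → Continuous u₀ → (∀ x, 0 < a₀ x) → (∀ x, 0 < θ₀ x) → ∃ σ₀ : ℝ, 0 < σ₀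 ∧ ∀ σ : ℝ, 0 < σ → σ < σ₀ → ∀ (T : ℝ) (ρ θ : ℝ → T3 → ℝ) (u : ℝ → T3 → V3), let E4 : ℝ → T3 → ℝ := fun s y => ρ s y * (‖u s y‖ ^ 2 / 2 + 3 * θ s y); Torus.IsSmoothSpaceTimeOn (Set.Ico 0 T) ρ → Torus.IsSmoothSpaceTimeOn (Set.Ico 0 T) u → Torus.IsSmoothSpaceTimeOn (Set.Ico 0 T) θ → (∀ t ∈ Set.Ico 0 T, ∀ x, 0 < ρ t x) → (∀ t ∈ Set.Ico 0 T, ∀ x, 0 < θ t x) → (∀ t ∈ Set.Ico 0 T, ∀ x, Torus.timeDerivWithin (Set.Ico 0 T) ρ t x + Torus.divergence (fun y => ρ t y • u t y) x = 0) → (∀ t ∈ Set.Ico 0 T, ∀ x, Torus.timeDerivWithin (Set.Ico 0 T) (fun s y => ρ s y • u s y) t x + (∑ i, Torus.partialDeriv i (fun y => (ρ t y * u t y i) • u t y) x) + Torus.gradient (fun y => hsPressure σ (ρ t y) (θ t y)) x = 0) → (∀ t ∈ Set.Ico 0 T, ∀ x, Torus.timeDerivWithin (Set.Ico 0 T) E4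 t x + Torus.divergence (fun y => (E4 t y + hsPressure σ (ρ t y) (θ t y)) • u t y) x = 0) → (∀ t ∈ Set.Ico 0 T, ∀ x, ρ t x * σ ^ 3 < η₀) → ∀ Φ : (N : ℕ) → HardSphereFlow G (ε σ N) (N + 1), let P := fun N => localGibbsLaw σ a₀ u₀ θ₀ N (Φ N); TendstoHydroFieldsAt P Φ ρ u θ 0 → ∀ t ∈ Set.Ico 0 T, ∀ χ : T3 → ℝ, Continuous χ → ∀ δ : ℝ, 0 < δ → let Q := fun N => (P N).prod (spinLaw N); let Z := fun N (p : Cfg N × Spin N) => (rflow (κs N) σ N (init θ₀ N p) t).1; Tendsto (fun N : ℕ => Q N {p | δ < |empiricalDensityField (Z N p) χ - ∫ x, χ x * ρ t x|}) atTop (nhds 0) ∧ Tendsto (fun N : ℕ => Q N {p | δ < ‖empiricalMomentumField (Z N p) χ - ∫ x, (χ x * ρ t x) • u t x‖}) atTop (nhds 0) ∧ Tendsto (fun N : ℕ => Q N {p | δ < |empiricalEnergyField (Z N p) χ - ∫ x, χ x * totalEnergyDensity (ρ t x) (u t x) (θ t x)|}) atTop (nhds 0)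

-- earlier SmallKappaAccuracy (stmt-AtomisticToContinuum-9275, replaced 2026-08-16T23:16:58Z -> stmt-AtomisticToContinuum-17359): retired by None — open MeasureTheory Filter ProbabilityTheory Literature.Analysis.FluidPDE Literature.MathematicalPhysics.KineticTheory Literature.Analysis.FunctionSpaces in let Cfg : ℕ → Type := fun N => Config (N + 1) (Fin 3) T3; let Spin : ℕ → Type := fun N => Fin (N + 
/-- item stmt-AtomisticToContinuum-17359 · crux · rank 6 · open · by planner
why it might fail: At κ_N = r(N+1)^(-1/3) kick variance per particle per unit time is O(r), bounded in N — below OVY's diverging-intensity regime: no printed ergodicity mechanism applies, local equilibrium must come from deterministic collisions; with KappaSwapGap it equals the guarded conjunct; quadratic-KE tails.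
sources: OllaVaradhanYau1993, Literature.Barriers.AtomisticToContinuum.MacroErgodicityBarrier, Literature.Barriers.AtomisticToContinuum.BoltzmannHypothesisBarrier, Literature.Barriers.AtomisticToContinuum.HighMomentumCutoffBarrier, Widom1960, ChenLevermoreLiu1994
[crux] ENDPOINT RUNG, PACKING-GUARDED (card R3's second half, accuracy form — the
Euler–Landau–Teller window read at small r through continuous dependence of classical relaxation
solutions on r, so no new PDE notion is needed; since the conjunct's re-type 2026-08-16 (p126922,
route-repair) the conjunct's packing guard is carried token for token: ∃ η₀ > 0 outermost, and only
classical hs-Euler solutions with ρ_t(x)σ³ < η₀ on [0,T) × 𝕋³ — a dilute FLUID, Spohn's regime,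
hsPressure on its analytic virial branch — are tracked; the rev-3 unguarded form implies this one
with η₀ := 1, `SmallKappaAccuracy_of_unguarded` in the planner's Sketch.lean). Same frame as
KappaSwapGap plus the guard; conclusion: for every t < T, continuous χ, δ > 0 and η > 0 there is r₀
> 0 such that for r ∈ (0,r₀) and N ≥ N₀(r), under P_N ⊗ γ the probability that the χ-tested
empirical density (resp. momentum, translational energy) field of R^(κ_N)_t, κ_N = r(N+1)^(-1/3),
deviates by more than δ from ∫χρ_t (resp. ∫χρ_t u_t, ∫χE_t with E = ρ(|u|²/2 + 3θ/2), the CONJUNCT's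
guarded hs-Euler solution) is ≤ η. With KappaSwapGap it yields `_root_.HydrodynamicLimit`
(DockingGlue: η₀ := this item's threshold, σ₀ := min of -/
@[route_item "route-AtomisticToContinuum-BryanRoughSphereDial", crux]
def SmallKappaAccuracy : Prop :=
  open MeasureTheory Filter ProbabilityTheory Literature.Analysis.FluidPDE Literature.MathematicalPhysics.KineticTheory Literature.Analysis.FunctionSpaces in let Cfg : ℕ → Type := fun N => Config (N + 1) (Fin 3) T3; let Spin : ℕ → Type := fun N => Fin (N + 1) → V3; let G := Torus.geometry (Fin 3); let ε : ℝ → ℕ → ℝ := hsDiameter; let τ : ℝ → (N : ℕ) → Cfg N → ENNReal := fun σ N z => Alexander.freeExitTime G (ε σ N) z; let S : ℝ → (N : ℕ) → Cfg N → Cfg N := fun t _ z => freeFlight G t z; let rpair : ℝ → (N : ℕ) → Fin (N + 1) → Fin (N + 1) → Cfg N × Spin N → Cfg N × Spin N := fun κ _ i j p => let z := p.1; let s := p.2; let n := G.sepVec (z i).1 (z j).1; let k := ‖n‖⁻¹ • n; let g := (z i).2 - (z j).2; let gt := g - (⟪g, k⟫_ℝ) • k; let S2 := s i + s j; let J :=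 -((⟪g, k⟫_ℝ) • k) - (κ / (1 + κ)) • gt - (Real.sqrt κ / (1 + κ)) • cross k S2; let ds := (Real.sqrt κ / (1 + κ)) • cross k gt + (1 / (1 + κ)) • cross k (cross k S2); (Function.update (Function.update z i ((z i).1, (z i).2 + J)) j ((z j).1, (z j).2 - J), Function.update (Function.update s i (s i + ds)) j (s j + ds)); let rstep : ℝ → ℝ → (N : ℕ) → Cfg N × Spin N → Cfg N × Spin N := fun κ σ N p => let z' := S (τ σ N p.1).toReal N p.1; if τ σ N p.1 = ⊤ then p else if h : (Alexander.incomingPairs G (ε σ N) z').Nonempty then rpair κ N h.some.1 h.some.2 (z', p.2) else (z', p.2); let rstate : ℝ → ℝ → (N : ℕ) → Cfg N × Spin N → ℕ → Cfg N × Spin N := fun κ σ N p k => (rstep κ σ N)^[k] p; let rinst : ℝ → ℝ → (N : ℕ) → Cfg N × Spin N → ℕ → ENNReal := fun κ σ N p k => ∑ m ∈ Finset.range k, τ σ N (rstate κ σ N p m).1; let rflow : ℝ → ℝ → (N : ℕ) → Cfg N × Spin N → ℝ → Cfg N × Spin N := fun κ σ N p t => let K := sSup {k : ℕ | rinst κ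 σ N p k ≤ ENNReal.ofReal t}; (S (t - (rinst κ σ N p K).toReal) N (rstate κ σ N p K).1, (rstate κ σ N p K).2); let spinLaw : (N : ℕ) → Measure (Spin N) := fun N => Measure.pi (fun _ : Fin (N + 1) => stdGaussian V3); let init : (T3 → ℝ) → (N : ℕ) → Cfg N × Spin N → Cfg N × Spin N := fun θ₀ _ p => (p.1, fun i => Real.sqrt (θ₀ (p.1 i).1) • p.2 i); ∃ η₀ : ℝ, 0 < η₀ ∧ ∀ (a₀ θ₀ : T3 → ℝ) (u₀ : T3 → V3), Continuous a₀ → Continuous θ₀ → Continuous u₀ → (∀ x, 0 < a₀ x) → (∀ x, 0 < θ₀ x) → ∃ σ₀ : ℝ, 0 < σ₀ ∧ ∀ σ : ℝ, 0 < σ → σ < σ₀ → ∀ (T : ℝ) (ρ θ : ℝ → T3 → ℝ) (u : ℝ → T3 → V3), IsHardSphereEulerSolution σ T ρ u θ → (∀ t ∈ Set.Ico 0 T, ∀ x, ρ t x * σ ^ 3 < η₀) → ∀ Φ : (N : ℕ) → HardSphereFlow G (ε σ N) (N + 1), let P := fun N => localGibbsLaw σ a₀ u₀ θ₀ N (Φ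 N); TendstoHydroFieldsAt P Φ ρ u θ 0 → ∀ t ∈ Set.Ico 0 T, ∀ χ : T3 → ℝ, Continuous χ → ∀ δ : ℝ, 0 < δ → ∀ η : ℝ, 0 < η → ∃ r₀ : ℝ, 0 < r₀ ∧ ∀ r : ℝ, 0 < r → r < r₀ → ∃ N₀ : ℕ, ∀ N : ℕ, N₀ ≤ N → let Q := (P N).prod (spinLaw N); let Z := fun p : Cfg N × Spin N => (rflow (r * ((N : ℝ) + 1) ^ (-(1 / 3 : ℝ))) σ N (init θ₀ N p) t).1; Q {p | δ < |empiricalDensityField (Z p) χ - ∫ x, χ x * ρ t x|} ≤ ENNReal.ofReal η ∧ Q {p | δ < ‖empiricalMomentumField (Z p) χ - ∫ x, (χ x * ρ t x) • u t x‖} ≤ ENNReal.ofReal η ∧ Q {p | δ < |empiricalEnergyField (Z p) χ - ∫ x, χ x * totalEnergyDensity (ρ t x) (u t x) (θ t x)|} ≤ ENNReal.ofReal η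

-- item stmt-AtomisticToContinuum-9558 · crux (kind.auto-crux: conjecture-grade) · rank 9 · open · by planner — informal only, no Lean statement yet:
--   [support] THE TWO-TEMPERATURE WINDOW (card crux 3 / rung R2 — Euler–Landau–Teller hydrodynamics from
--   Newton, new even as a conjecture; informal until defn-IsLandauTellerEulerSolution lands; the
--   intended layer-2 parent of SmallKappaAccuracy together with continuous dependence of classical
--   relaxation solutions on r at r = 0). Along κ_N(N+1)^(1/3) → r ∈ (0,∞), from rough local Gibbs data
--   (θ_rot = θ_tr = θ₀), pre-shock, the empirical density, momentum, translational-energy and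
--   rotational-energy (N⁻¹Σχ(x_i)|s_i|²/2) fields of the rough flow converge in probability to the
--   classical solution of ∂_tρ

-- item stmt-AtomisticToContinuum-9542 · support · rank 3 · open · by planner — informal only, no Lean statement yet:
--   [crux] SPIN CHAOS (card crux 1; the engine of the analogue rungs; informal until definition request
--   defn-RoughSphereFlow — the RoughSphereFlow API with its empirical collision/spin measures — lands,
--   then typed by set-signature). Rough-sphere gas on 𝕋³ (Bryan's rule as in KappaSwapGap's let block),
--   reduced density σ < σ₀, rough local Gibbs data (thermal spins at θ₀), pre-shock horizon [0,t]. (a)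
--   FIXED κ ∈ (0,2/3] (feeds RoughEulerFixedKappa): for mesoscopic space-time cells (side ℓ_N, N^(-1/3)
--   ≪ ℓ_N ≪ 1; duration M mean free times) the empirical joint law of (incoming normalised pair data (k,
--   g

-- item stmt-AtomisticToContinuum-9544 · support · rank 4 · open · by planner — informal only, no Lean statement yet:
--   [crux] MACRO-ERGODICITY OF THE CONTACT-LANGEVIN HARD-SPHERE GAS (card crux 2; the
--   FritzFunakiLebowitz1994 / LiveraniOlla1996 theorem for a conservative noise living on contacts;
--   informal until defn-ContactLangevinGas and defn-RegularStationaryState land). Infinite-volume hard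
--   spheres (diameter 1, reduced density < η₀) under Alexander's a.s. dynamics in which, at each binary
--   contact with unit normal k, incoming relative velocity g (tangential part g_t), the pair receives
--   the impulse ±J with J = −(g·k)k − κ(1+κ)⁻¹ g_t − √κ(1+κ)⁻¹ k × Σ, Σ ~ N(0, 2θ_b·Id) drawn afresh at
--   every contact (the spin-m

-- earlier RoughWellPosed (stmt-AtomisticToContinuum-9277, replaced 2026-08-15T16:33:24Z -> stmt-AtomisticToContinuum-10948): retired by None — open MeasureTheory Filter ProbabilityTheory Literature.Analysis.FluidPDE Literature.MathematicalPhysics.KineticTheory Literature.Analysis.FunctionSpaces in let Cfg : ℕ → Type := fun N => Config (N + 1) (Fin 3) T3; let Spin : ℕ → Type := fun N => Fin (N + 1) →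
/-- item stmt-AtomisticToContinuum-10948 · support · rank 9 · open · by planner
sources: CIP1994, GST2013, ChapmanCowling1970, CoxFeres2016
[support] ALEXANDER'S THEOREM FOR THE ROUGH FLOW (every κ ≥ 0, 0 < σ < 1/2, every N): (a) p ↦ R^κ_t
p is measurable for each t; (b) for Liouville ⊗ Lebesgue-a.e. (z, s) every finite exit configuration
of the rough recursion is a simple incoming collision — stated INLINE (cone repair 2026-08-15: ∃
ordered pair q.1 < q.2 with ⟪sepVec, relative velocity⟫ < 0 whose contact set is the only one;
definitionally `Alexander.IsSimpleIncoming`, `Iff.rfl`-checked in the planner's Sketch.lean) — no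
pair touches strictly inside a free flight, and the exit times sum to ∞ (the three `FwdGood` clauses
for rstate); (c) R^κ_t preserves Liouville ⊗ Lebesgue(spins) for t ≥ 0. Same proof as
`torusFlow_ae_good_holds` / `torusFlow_measurePreserving_holds` (CIP1994 App. 4.A): the rule is a
linear isometry of (v_i,v_j,s_i,s_j) reversing g·k, so it maps the incoming flux measure |g·k| dS dv
ds onto the outgoing one; the map is discontinuous at grazing (ChapmanCowling1970 §11.8), which the
measure argument does not mind. [difficulty: M] [CIP1994, GST2013, ChapmanCowling1970, CoxFeres2016] -/
@[route_item "route-AtomisticToContinuum-BryanRoughSphereDial"]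
def RoughWellPosed : Prop :=
  open MeasureTheory Filter ProbabilityTheory Literature.Analysis.FluidPDE Literature.MathematicalPhysics.KineticTheory Literature.Analysis.FunctionSpaces in let Cfg : ℕ → Type := fun N => Config (N + 1) (Fin 3) T3; let Spin : ℕ → Type := fun N => Fin (N + 1) → V3; let G := Torus.geometry (Fin 3); let ε : ℝ → ℕ → ℝ := hsDiameter; let τ : ℝ → (N : ℕ) → Cfg N → ENNReal := fun σ N z => Alexander.freeExitTime G (ε σ N) z; let S : ℝ → (N : ℕ) → Cfg N → Cfg N := fun t _ z => freeFlight G t z; let rpair : ℝ → (N : ℕ) → Fin (N + 1) → Fin (N + 1) → Cfg N × Spin N → Cfg N × Spin N := fun κ _ i j p => let z := p.1; let s := p.2; let n := G.sepVec (z i).1 (z j).1; let k := ‖n‖⁻¹ • n; let g := (z i).2 - (z j).2; let gt := g - (⟪g, k⟫_ℝ) • k; let S2 := s i + s j; let J := -((⟪g, k⟫_ℝ) • k) - (κ / (1 + κ)) • gt - (Real.sqrt κ / (1 + κ)) • cross k S2; let ds := (Real.sqrt κ / (1 + κ)) • cross k gt + (1 / (1 + κ)) • cross k (cross k S2); (Function.update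 (Function.update z i ((z i).1, (z i).2 + J)) j ((z j).1, (z j).2 - J), Function.update (Function.update s i (s i + ds)) j (s j + ds)); let rstep : ℝ → ℝ → (N : ℕ) → Cfg N × Spin N → Cfg N × Spin N := fun κ σ N p => let z' := S (τ σ N p.1).toReal N p.1; if τ σ N p.1 = ⊤ then p else if h : (Alexander.incomingPairs G (ε σ N) z').Nonempty then rpair κ N h.some.1 h.some.2 (z', p.2) else (z', p.2); let rstate : ℝ → ℝ → (N : ℕ) → Cfg N × Spin N → ℕ → Cfg N × Spin N := fun κ σ N p k => (rstep κ σ N)^[k] p; let rinst : ℝ → ℝ → (N : ℕ) → Cfg N × Spin N → ℕ → ENNReal := fun κ σ N p k => ∑ m ∈ Finset.range k, τ σ N (rstate κ σ N p m).1; let rflow : ℝ → ℝ → (N : ℕ) → Cfg N × Spin N → ℝ → Cfg N × Spin N := fun κ σ N p t => let K := sSup {k : ℕ | rinst κ σ N p k ≤ ENNReal.ofReal t}; (S (t - (rinst κ σ N p K).toReal) N (rstate κ σ N p K).1, (rstate κ σ N p K).2); ∀ κ : ℝ, 0 ≤ κ → ∀ σ : ℝ, 0 < σ → σ < 2⁻¹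 → ∀ N : ℕ, let μ : Measure (Cfg N × Spin N) := (liouville G (N + 1) (ε σ N)).prod volume; (∀ t : ℝ, Measurable (fun p : Cfg N × Spin N => rflow κ σ N p t)) ∧ (∀ᵐ p ∂μ, (let L := rstate κ σ N p; (∀ k, τ σ N (L k).1 ≠ ⊤ → (let w := S (τ σ N (L k).1).toReal N (L k).1; ∃ q : Fin (N + 1) × Fin (N + 1), q.1 < q.2 ∧ ⟪G.sepVec (w q.1).1 (w q.2).1, (w q.1).2 - (w q.2).2⟫_ℝ < 0 ∧ ∀ i j : Fin (N + 1), i ≠ j → (w ∈ contactSet G (N + 1) (ε σ N) i j ↔ ({i, j} : Finset (Fin (N + 1))) = {q.1, q.2}))) ∧ (∀ k (s : ℝ), 0 < s → ENNReal.ofReal s < τ σ N (L k).1 → ∀ i j : Fin (N + 1), i ≠ j → S s N (L k).1 ∉ contactSet G (N + 1) (ε σ N) i j) ∧ ∑' k, τ σ N (L k).1 = ⊤)) ∧ (∀ t : ℝ, 0 ≤ t → MeasurePreserving (fun p : Cfg N × Spin N => rflow κ σ N p t) μ μ)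

-- earlier RoughEulerFixedKappa (stmt-AtomisticToContinuum-9276, replaced 2026-08-16T23:37:21Z -> stmt-AtomisticToContinuum-17784): retired by None — open MeasureTheory Filter ProbabilityTheory Literature.Analysis.FluidPDE Literature.MathematicalPhysics.KineticTheory Literature.Analysis.FunctionSpaces in let Cfg : ℕ → Type := fun N => Config (N + 1) (Fin 3) T3; let Spin : ℕ → Type := fun N => Fin (N 
/-- item stmt-AtomisticToContinuum-17784 · support · rank 9 · open · by planner
sources: ChapmanCowling1970, CondiffLuDahler1965, OllaVaradhanYau1993, FritzFunakiLebowitz1994, CoxFeres2016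
[support] ANALOGUE THEOREM AT FIXED ROUGHNESS, PACKING-GUARDED (card rung R1; support — it does not
drive staffing, VanishingKappaEuler does): ∃ η₀ > 0 (packing threshold, outermost — the conjunct's
guard carried since the 2026-08-16 re-type, p126922; implied by the rev-3 form with η₀ := 1,
`RoughEulerFixedKappa_of_unguarded` in Sketch.lean) such that for every κ ∈ (0, 2/3] and continuous
profiles ∃ σ₀ ∀ σ < σ₀: γ = 4/3 hard-sphere Euler (inline clauses as in VanishingKappaEuler,
solutions with ρ_t(x)σ³ < η₀ on [0,T) × 𝕋³) from the deterministic rough-sphere flow R^κ with rough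
local Gibbs data, pre-shock, convergence in probability of density, momentum and
translational-energy fields (the latter to ρ(|u|²/2 + 3θ/2)). Expected proof: SpinChaos (fixed-κ
form) ⇒ contact-Langevin reduction ⇒ ContactLangevinErgodicity ⇒ OVY §4 (C)–(E) + relative-entropy
bookkeeping with contact currents, EOS from the conjunct's statics (VirialEosIdentification 0782,
LocalGibbsConcentration 0767 apply verbatim: same excluded volume). [difficulty: open-problem] -/
@[route_item "route-AtomisticToContinuum-BryanRoughSphereDial"]
def RoughEulerFixedKappa : Prop :=
  open MeasureTheory Filter ProbabilityTheory Literature.Analysis.FluidPDE Literature.MathematicalPhysics.KineticTheory Literature.Analysis.FunctionSpaces in let Cfg : ℕ → Type := fun N => Config (N + 1) (Fin 3) T3; let Spin : ℕ → Type := fun N => Fin (N + 1) → V3; let G := Torus.geometry (Fin 3); let ε : ℝ → ℕ → ℝ := hsDiameter; let τ : ℝ → (N : ℕ) → Cfg N → ENNReal := fun σ N z => Alexander.freeExitTime G (ε σ N) z; let S : ℝ → (N : ℕ) → Cfg N → Cfg N := fun t _ z => freeFlight G t z; let rpair : ℝ → (N : ℕ) → Fin (N + 1) → Fin (N + 1)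 → Cfg N × Spin N → Cfg N × Spin N := fun κ _ i j p => let z := p.1; let s := p.2; let n := G.sepVec (z i).1 (z j).1; let k := ‖n‖⁻¹ • n; let g := (z i).2 - (z j).2; let gt := g - (⟪g, k⟫_ℝ) • k; let S2 := s i + s j; let J := -((⟪g, k⟫_ℝ) • k) - (κ / (1 + κ)) • gt - (Real.sqrt κ / (1 + κ)) • cross k S2; let ds := (Real.sqrt κ / (1 + κ)) • cross k gt + (1 / (1 + κ)) • cross k (cross k S2); (Function.update (Function.update z i ((z i).1, (z i).2 + J)) j ((z j).1, (z j).2 - J), Function.update (Function.update s i (s i + ds)) j (s j + ds)); let rstep : ℝ → ℝ → (N : ℕ) → Cfg N × Spin N → Cfg N × Spin N := fun κ σ N p => let z' := S (τ σ N p.1).toReal N p.1; if τ σ N p.1 = ⊤ then p else if h : (Alexander.incomingPairs G (ε σ N) z').Nonempty then rpair κ N h.some.1 h.some.2 (z', p.2) else (z', p.2); let rstate : ℝ → ℝ → (N : ℕ) → Cfg N × Spin N → ℕ → Cfg N × Spin N := fun κ σ N p k => (rstep κ σ N)^[k] p; let rinst : ℝ → ℝ → (N : ℕ) → Cfg N ×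 Spin N → ℕ → ENNReal := fun κ σ N p k => ∑ m ∈ Finset.range k, τ σ N (rstate κ σ N p m).1; let rflow : ℝ → ℝ → (N : ℕ) → Cfg N × Spin N → ℝ → Cfg N × Spin N := fun κ σ N p t => let K := sSup {k : ℕ | rinst κ σ N p k ≤ ENNReal.ofReal t}; (S (t - (rinst κ σ N p K).toReal) N (rstate κ σ N p K).1, (rstate κ σ N p K).2); let spinLaw : (N : ℕ) → Measure (Spin N) := fun N => Measure.pi (fun _ : Fin (N + 1) => stdGaussian V3); let init : (T3 → ℝ) → (N : ℕ) → Cfg N × Spin N → Cfg N × Spin N := fun θ₀ _ p => (p.1, fun i => Real.sqrt (θ₀ (p.1 i).1) • p.2 i); ∃ η₀ : ℝ, 0 < η₀ ∧ ∀ κ : ℝ, 0 < κ → κ ≤ 2 / 3 → ∀ (a₀ θ₀ : T3 → ℝ) (u₀ : T3 → V3), Continuous a₀ → Continuous θ₀ → Continuous u₀ → (∀ x, 0 < a₀ x) → (∀ x, 0 < θ₀ x) → ∃ σ₀ : ℝ, 0 < σ₀ ∧ ∀ σ : ℝ, 0 < σ → σ < σ₀ → ∀ (T : ℝ) (ρ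 θ : ℝ → T3 → ℝ) (u : ℝ → T3 → V3), let E4 : ℝ → T3 → ℝ := fun s y => ρ s y * (‖u s y‖ ^ 2 / 2 + 3 * θ s y); Torus.IsSmoothSpaceTimeOn (Set.Ico 0 T) ρ → Torus.IsSmoothSpaceTimeOn (Set.Ico 0 T) u → Torus.IsSmoothSpaceTimeOn (Set.Ico 0 T) θ → (∀ t ∈ Set.Ico 0 T, ∀ x, 0 < ρ t x) → (∀ t ∈ Set.Ico 0 T, ∀ x, 0 < θ t x) → (∀ t ∈ Set.Ico 0 T, ∀ x, Torus.timeDerivWithin (Set.Ico 0 T) ρ t x + Torus.divergence (fun y => ρ t y • u t y) x = 0) → (∀ t ∈ Set.Ico 0 T, ∀ x, Torus.timeDerivWithin (Set.Ico 0 T) (fun s y => ρ s y • u s y) t x + (∑ i, Torus.partialDeriv i (fun y => (ρ t y * u t y i) • u t y) x) + Torus.gradient (fun y => hsPressure σ (ρ t y) (θ t y)) x = 0) → (∀ t ∈ Set.Ico 0 T, ∀ x, Torus.timeDerivWithin (Set.Ico 0 T) E4 t x + Torus.divergence (fun y => (E4 t y + hsPressure σ (ρ t y) (θ t y)) • u t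 y) x = 0) → (∀ t ∈ Set.Ico 0 T, ∀ x, ρ t x * σ ^ 3 < η₀) → ∀ Φ : (N : ℕ) → HardSphereFlow G (ε σ N) (N + 1), let P := fun N => localGibbsLaw σ a₀ u₀ θ₀ N (Φ N); TendstoHydroFieldsAt P Φ ρ u θ 0 → ∀ t ∈ Set.Ico 0 T, ∀ χ : T3 → ℝ, Continuous χ → ∀ δ : ℝ, 0 < δ → let Q := fun N => (P N).prod (spinLaw N); let Z := fun N (p : Cfg N × Spin N) => (rflow κ σ N (init θ₀ N p) t).1; Tendsto (fun N : ℕ => Q N {p | δ < |empiricalDensityField (Z N p) χ - ∫ x, χ x * ρ t x|}) atTop (nhds 0) ∧ Tendsto (fun N : ℕ => Q N {p | δ < ‖empiricalMomentumField (Z N p) χ - ∫ x, (χ x * ρ t x) • u t x‖}) atTop (nhds 0) ∧ Tendsto (fun N : ℕ => Q N {p | δ < |empiricalEnergyField (Z N p) χ - ∫ x, χ x * totalEnergyDensity (ρ t x) (u t x) (θ t x)|}) atTop (nhds 0)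

/-- item stmt-AtomisticToContinuum-9278 · support · rank 9 · open · by planner
sources: CIP1994, ChapmanCowling1970
[support] UNIT TEST OF THE DIAL'S ENDPOINT (provable now, by unfolding and induction on the
collision index): at κ = 0 the typed rule is J = −(g·k)k = `collidePair` on the translational
variables and the spin update does not feed back, so the translational projection of R^0 is the
library's `Alexander.fwdFlow` for every σ, N, initial (z, s) and t (same branching on `freeExitTime
= ⊤` / `incomingPairs`, same `Set.Nonempty.some`). [difficulty: provable-now] -/
@[route_item "route-AtomisticToContinuum-BryanRoughSphereDial"]
def KappaZeroReduction : Prop :=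
  open MeasureTheory Filter ProbabilityTheory Literature.Analysis.FluidPDE Literature.MathematicalPhysics.KineticTheory Literature.Analysis.FunctionSpaces in let Cfg : ℕ → Type := fun N => Config (N + 1) (Fin 3) T3; let Spin : ℕ → Type := fun N => Fin (N + 1) → V3; let G := Torus.geometry (Fin 3); let ε : ℝ → ℕ → ℝ := hsDiameter; let τ : ℝ → (N : ℕ) → Cfg N → ENNReal := fun σ N z => Alexander.freeExitTime G (ε σ N) z; let S : ℝ → (N : ℕ) → Cfg N → Cfg N := fun t _ z => freeFlight G t z; let rpair : ℝ → (N : ℕ) → Fin (N + 1) → Fin (N + 1) → Cfg N × Spin N → Cfg N × Spin N := fun κ _ i j p => let z := p.1; let s := p.2; let n := G.sepVec (z i).1 (z j).1; let k := ‖n‖⁻¹ • n; let g := (z i).2 - (z j).2; let gt := g - (⟪g, k⟫_ℝ) • k; let S2 := s i + s j; let J := -((⟪g, k⟫_ℝ) • k) - (κ / (1 + κ)) • gt - (Real.sqrt κ / (1 + κ)) • cross k S2; let ds := (Real.sqrt κ / (1 + κ)) • cross k gt + (1 / (1 + κ)) • cross k (cross k S2); (Function.update (Function.update z i ((z i).1,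 (z i).2 + J)) j ((z j).1, (z j).2 - J), Function.update (Function.update s i (s i + ds)) j (s j + ds)); let rstep : ℝ → ℝ → (N : ℕ) → Cfg N × Spin N → Cfg N × Spin N := fun κ σ N p => let z' := S (τ σ N p.1).toReal N p.1; if τ σ N p.1 = ⊤ then p else if h : (Alexander.incomingPairs G (ε σ N) z').Nonempty then rpair κ N h.some.1 h.some.2 (z', p.2) else (z', p.2); let rstate : ℝ → ℝ → (N : ℕ) → Cfg N × Spin N → ℕ → Cfg N × Spin N := fun κ σ N p k => (rstep κ σ N)^[k] p; let rinst : ℝ → ℝ → (N : ℕ) → Cfg N × Spin N → ℕ → ENNReal := fun κ σ N p k => ∑ m ∈ Finset.range k, τ σ N (rstate κ σ N p m).1; let rflow : ℝ → ℝ → (N : ℕ) → Cfg N × Spin N → ℝ → Cfg N × Spin N := fun κ σ N p t => let K := sSup {k : ℕ | rinst κ σ N p k ≤ ENNReal.ofReal t}; (S (t - (rinst κ σ N p K).toReal) N (rstate κ σ N p K).1, (rstate κ σ N p K).2); ∀ (σ : ℝ) (N : ℕ) (p : Cfg N × Spin N) (t : ℝ), (rflow 0 σ N p t).1 = Alexander.fwdFlow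 G (ε σ N) p.1 t

/-- item stmt-AtomisticToContinuum-9280 · assembly · rank 1 · open · by planner
sources: OllaVaradhanYau1993, KipnisLandim1999
[assembly] KappaSwapGap → SmallKappaAccuracy → HydrodynamicLimit (the sub-problem Statement decl, by
name). -/
@[route_item "route-AtomisticToContinuum-BryanRoughSphereDial"]
def Assembly : Prop :=
  KappaSwapGap → SmallKappaAccuracy → _root_.HydrodynamicLimit

/-! D-0027 §2.1 — DECIDING THEOREM (planner-authored via `route open/edit --closes-file`; by planner-rrepair-AtomisticToContinuum-BryanRoug-60347806-0 2026-08-16T23:36:45Z):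
its hypotheses are this route's items and its conclusion the sub-problem Statement (glue_lint), and it elaborates with this file. -/

@[closes "route-AtomisticToContinuum-BryanRoughSphereDial"] theorem closes : KappaSwapGap → SmallKappaAccuracy → _root_.HydrodynamicLimit := by
  intro hgap hacc
  have hlim : ∀ (p : ℕ → ENNReal) (m : ℝ), 0 < m →
      (∀ η : ℝ, 0 < η → ∃ N₀ : ℕ, ∀ N, N₀ ≤ N → ENNReal.ofReal m * p N ≤ ENNReal.ofReal η) →
      Tendsto p atTop (𝓝 0) := by
    intro p m hm h
    rw [ENNReal.tendsto_nhds_zero]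
    intro ε hε
    rcases eq_or_ne ε ⊤ with rfl | hεtop
    · exact Eventually.of_forall fun _ => le_top
    obtain ⟨N₀, hN₀⟩ := h (m * ε.toReal) (mul_pos hm (ENNReal.toReal_pos hε.ne' hεtop))
    refine eventually_atTop.2 ⟨N₀, fun N hN => ?_⟩
    have h1 := hN₀ N hN
    rw [ENNReal.ofReal_mul hm.le] at h1
    exact ((ENNReal.mul_le_mul_iff_right (ENNReal.ofReal_pos.2 hm).ne' ENNReal.ofReal_ne_top).1
      h1).trans ENNReal.ofReal_toReal_le
  have hkey : ∀ {α β : Type} [MeasurableSpace α] [MeasurableSpace β] (P : Measure α)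
      (Q : Measure β), IsProbabilityMeasure P → IsProbabilityMeasure Q →
      ∀ (D : α → ℝ) (D' : β → ℝ), Measurable D → ∀ (δ η : ℝ), 0 < η →
      |(∫ a, min 1 (max 0 (D a - δ / 2)) ∂P) - ∫ b, min 1 (max 0 (D' b - δ / 2)) ∂Q| ≤ η →
      Q {b | δ / 2 < D' b} ≤ ENNReal.ofReal η →
      ENNReal.ofReal (min 1 (δ / 2)) * P {a | δ < D a} ≤ ENNReal.ofReal (2 * η) := by
    intro α β _ _ P Q hPi hQi D D' hD δ η hη hgap hacc
    haveI := hPi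
    haveI := hQi
    set φ : ℝ → ℝ := fun x => min 1 (max 0 (x - δ / 2)) with hφ
    have hφ0 : ∀ x, 0 ≤ φ x := fun x => le_min zero_le_one (le_max_left _ _)
    have hφ1 : ∀ x, φ x ≤ 1 := fun x => min_le_left _ _
    have hDφ : Measurable fun a => φ (D a) :=
      (continuous_const.min (continuous_const.max (continuous_id.sub continuous_const))).measurable.comp hD
    have hS : {a | δ < D a} ⊆ {a | ENNReal.ofReal (min 1 (δ / 2)) ≤ ENNReal.ofReal (φ (D a))} :=
      fun a (ha : δ < D a) => ENNReal.ofReal_le_ofReal (min_le_min le_rfl (le_max_of_le_right (by linarith)))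
    have h1 : ENNReal.ofReal (min 1 (δ / 2)) * P {a | δ < D a} ≤ ∫⁻ a, ENNReal.ofReal (φ (D a)) ∂P :=
      calc ENNReal.ofReal (min 1 (δ / 2)) * P {a | δ < D a}
          ≤ ENNReal.ofReal (min 1 (δ / 2)) *
              P {a | ENNReal.ofReal (min 1 (δ / 2)) ≤ ENNReal.ofReal (φ (D a))} := by gcongr
        _ ≤ ∫⁻ a, ENNReal.ofReal (φ (D a)) ∂P := mul_meas_ge_le_lintegral₀ hDφ.ennreal_ofReal.aemeasurable _
    have h2 : ∫⁻ a, ENNReal.ofReal (φ (D a)) ∂P = ENNReal.ofReal (∫ a, φ (D a) ∂P) :=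
      (ofReal_integral_eq_lintegral_ofReal (Integrable.of_mem_Icc 0 1 hDφ.aemeasurable
        (Eventually.of_forall fun a => ⟨hφ0 _, hφ1 _⟩))
        (Eventually.of_forall fun a => hφ0 _)).symm
    have h3 : ∫ b, φ (D' b) ∂Q ≤ η := by
      by_cases hi : Integrable (fun b => φ (D' b)) Q
      · rw [integral_eq_lintegral_of_nonneg_ae (Eventually.of_forall fun b => hφ0 _)
          hi.aestronglyMeasurable]
        have h4 : ∫⁻ b, ENNReal.ofReal (φ (D' b)) ∂Q ≤ Q {b | δ / 2 < D' b} :=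
          calc ∫⁻ b, ENNReal.ofReal (φ (D' b)) ∂Q
              ≤ ∫⁻ b, {b | δ / 2 < D' b}.indicator 1 b ∂Q := by
                refine lintegral_mono fun b => ?_
                by_cases hb : δ / 2 < D' b
                · rw [Set.indicator_of_mem (show b ∈ {b | δ / 2 < D' b} from hb), Pi.one_apply]
                  exact ENNReal.ofReal_le_one.2 (hφ1 _)
                · have hz : φ (D' b) = 0 := by
                    have : max 0 (D' b - δ / 2) = 0 := max_eq_left (by linarith)
                    simp only [hφ, this]
                    simp
                  simp [hz]
            _ ≤ Q {b | δ / 2 < D' b} := lintegral_indicator_one_le _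
        calc (∫⁻ b, ENNReal.ofReal (φ (D' b)) ∂Q).toReal
            ≤ (Q {b | δ / 2 < D' b}).toReal := ENNReal.toReal_mono (measure_ne_top _ _) h4
          _ ≤ (ENNReal.ofReal η).toReal := ENNReal.toReal_mono ENNReal.ofReal_ne_top hacc
          _ = η := ENNReal.toReal_ofReal hη.le
      · rw [integral_undef hi]
        exact hη.le
    have h5 : ∫ a, φ (D a) ∂P ≤ 2 * η := by linarith [(abs_sub_le_iff.1 hgap).1]
    exact h1.trans (h2.le.trans (ENNReal.ofReal_le_ofReal h5))
  have hφL : ∀ δ : ℝ, LipschitzWith 1 (fun x : ℝ => min 1 (max 0 (x - δ / 2))) := fun δ =>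
    ((LipschitzWith.mk_one fun x y => by
      rw [Real.dist_eq, Real.dist_eq, sub_sub_sub_cancel_right]).const_max 0).const_min 1
  have hLa : ∀ c : ℝ, LipschitzWith 1 (fun x : ℝ => |x - c|) := fun c =>
    LipschitzWith.mk_one fun x y => by
      rw [Real.dist_eq, Real.dist_eq, ← sub_sub_sub_cancel_right x y c]
      exact abs_abs_sub_abs_le_abs_sub _ _
  have hLn : ∀ c : EuclideanSpace ℝ (Fin 3), LipschitzWith 1 (fun v => ‖v - c‖) := fun c =>
    LipschitzWith.mk_one fun v w => by
      rw [Real.dist_eq, dist_eq_norm, ← sub_sub_sub_cancel_right v w c]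
      exact abs_norm_sub_norm_le _ _
  have hp1 : LipschitzWith 1 (Prod.fst : ℝ × EuclideanSpace ℝ (Fin 3) × ℝ → ℝ) := LipschitzWith.prod_fst
  have hp2 : LipschitzWith 1 (fun y : ℝ × EuclideanSpace ℝ (Fin 3) × ℝ => y.2.1) :=
    (LipschitzWith.prod_fst.comp LipschitzWith.prod_snd).weaken (mul_one _).le
  have hp3 : LipschitzWith 1 (fun y : ℝ × EuclideanSpace ℝ (Fin 3) × ℝ => y.2.2) :=
    (LipschitzWith.prod_snd.comp LipschitzWith.prod_snd).weaken (mul_one _).le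
  have hF : ∀ g : ℝ × EuclideanSpace ℝ (Fin 3) × ℝ → ℝ, LipschitzWith (1 * 1) g → ∀ δ : ℝ,
      LipschitzWith 1 (fun y => min 1 (max 0 (g y - δ / 2))) ∧ ∀ y, |min 1 (max 0 (g y - δ / 2))| ≤ 1 :=
    fun g hg δ => ⟨by simpa [Function.comp_def] using (hφL δ).comp hg, fun y =>
      abs_le.2 ⟨by linarith [le_min zero_le_one (le_max_left 0 (g y - δ / 2))], min_le_left _ _⟩⟩
  have hco : ∀ (N : ℕ) (i : Fin (N + 1)), Measurable
      fun z : Fin (N + 1) → UnitAddTorus (Fin 3) × EuclideanSpace ℝ (Fin 3) => z i :=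
    fun N i => measurable_pi_apply i
  have hm1 : ∀ (N : ℕ) (χ : UnitAddTorus (Fin 3) → ℝ), Continuous χ →
      Measurable fun z => Literature.MathematicalPhysics.KineticTheory.empiricalDensityField (N := N + 1) z χ := by
    intro N χ hχ
    simp_rw [Literature.MathematicalPhysics.KineticTheory.empiricalDensityField_eq_sum]
    exact measurable_const.mul (Finset.measurable_sum _ fun i _ => hχ.measurable.comp (hco N i).fst)
  have hm2 : ∀ (N : ℕ) (χ : UnitAddTorus (Fin 3) → ℝ), Continuous χ →
      Measurable fun z => Literature.MathematicalPhysics.KineticTheory.empiricalMomentumField (N := N + 1) z χ := by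
    intro N χ hχ
    simp_rw [Literature.MathematicalPhysics.KineticTheory.empiricalMomentumField_eq_sum]
    exact (Finset.measurable_sum _ fun i _ =>
      (hχ.measurable.comp (hco N i).fst).smul (hco N i).snd).const_smul (((N + 1 : ℕ) : ℝ)⁻¹)
  have hm3 : ∀ (N : ℕ) (χ : UnitAddTorus (Fin 3) → ℝ), Continuous χ →
      Measurable fun z => Literature.MathematicalPhysics.KineticTheory.empiricalEnergyField (N := N + 1) z χ := by
    intro N χ hχ
    simp_rw [Literature.MathematicalPhysics.KineticTheory.empiricalEnergyField_eq_sum]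
    exact measurable_const.mul (Finset.measurable_sum _ fun i _ =>
      (hχ.measurable.comp (hco N i).fst).mul (((hco N i).snd.norm.pow_const 2).div_const 2))
  obtain ⟨η₀, hη₀, hacc⟩ := hacc
  refine ⟨η₀, hη₀, fun a₀ θ₀ u₀ ha hθ hu hap hθp => ?_⟩
  obtain ⟨σ₁, hσ₁, Hgap⟩ := hgap a₀ θ₀ u₀ ha hθ hu hap hθp
  obtain ⟨σ₂, hσ₂, Hacc⟩ := hacc a₀ θ₀ u₀ ha hθ hu hap hθp
  refine ⟨min (min σ₁ σ₂) (1 / 2), by positivity, fun σ hσ hσlt T ρ θ u hsol hguard Φ h0 t ht => ?_⟩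
  have HG := Hgap σ hσ (hσlt.trans_le ((min_le_left _ _).trans (min_le_left _ _)))
    T ρ θ u hsol Φ h0 t ht
  have HA := Hacc σ hσ (hσlt.trans_le ((min_le_left _ _).trans (min_le_right _ _)))
    T ρ θ u hsol hguard Φ h0 t ht
  have hP : ∀ N, IsProbabilityMeasure (Literature.MathematicalPhysics.KineticTheory.localGibbsLaw σ a₀ u₀ θ₀ N (Φ N)) :=
    fun N => Literature.MathematicalPhysics.KineticTheory.isProbabilityMeasure_localGibbsLaw ha hθ hu hap hθp ((le_of_lt hσlt).trans (min_le_right _ _)) N (Φ N)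
  intro χ hχ δ hδ
  have hlt : ∀ {a b : ℝ}, 0 < b → a ≤ b → a / 2 < b := fun hb hab => by linarith
  have main : ∀ η : ℝ, 0 < η → ∃ N₀ : ℕ, ∀ N, N₀ ≤ N →
      ENNReal.ofReal (min 1 (δ / 2)) * Literature.MathematicalPhysics.KineticTheory.localGibbsLaw σ a₀ u₀ θ₀ N (Φ N)
          {z | δ < |Literature.MathematicalPhysics.KineticTheory.empiricalDensityField ((Φ N).flow t z) χ - ∫ x, χ x * ρ t x|} ≤ ENNReal.ofReal η ∧
      ENNReal.ofReal (min 1 (δ / 2)) * Literature.MathematicalPhysics.KineticTheory.localGibbsLaw σ a₀ u₀ θ₀ N (Φ N)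
          {z | δ < ‖Literature.MathematicalPhysics.KineticTheory.empiricalMomentumField ((Φ N).flow t z) χ - ∫ x, (χ x * ρ t x) • u t x‖} ≤
        ENNReal.ofReal η ∧
      ENNReal.ofReal (min 1 (δ / 2)) * Literature.MathematicalPhysics.KineticTheory.localGibbsLaw σ a₀ u₀ θ₀ N (Φ N)
          {z | δ < |Literature.MathematicalPhysics.KineticTheory.empiricalEnergyField ((Φ N).flow t z) χ -
            ∫ x, χ x * Literature.MathematicalPhysics.KineticTheory.totalEnergyDensity (ρ t x) (u t x) (θ t x)|} ≤ ENNReal.ofReal η := by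
    intro η hη
    set c₁ : ℝ := ∫ x, χ x * ρ t x
    set c₂ := ∫ x, (χ x * ρ t x) • u t x
    set c₃ : ℝ := ∫ x, χ x * Literature.MathematicalPhysics.KineticTheory.totalEnergyDensity (ρ t x) (u t x) (θ t x)
    have hF1 := hF _ ((hLa c₁).comp hp1) δ
    obtain ⟨r₁, hr₁, H1⟩ := HG χ hχ _ hF1.1 hF1.2 (η / 2) (by positivity)
    have hF2 := hF _ ((hLn c₂).comp hp2) δ
    obtain ⟨r₂, hr₂, H2⟩ := HG χ hχ _ hF2.1 hF2.2 (η / 2) (by positivity)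
    have hF3 := hF _ ((hLa c₃).comp hp3) δ
    obtain ⟨r₃, hr₃, H3⟩ := HG χ hχ _ hF3.1 hF3.2 (η / 2) (by positivity)
    obtain ⟨r₄, hr₄, H4⟩ := HA χ hχ (δ / 2) (by positivity) (η / 2) (by positivity)
    have hr : 0 < min (min r₁ r₂) (min r₃ r₄) / 2 := by positivity
    obtain ⟨N₁, HN1⟩ := H1 _ hr (hlt hr₁ ((min_le_left _ _).trans (min_le_left _ _)))
    obtain ⟨N₂, HN2⟩ := H2 _ hr (hlt hr₂ ((min_le_left _ _).trans (min_le_right _ _)))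
    obtain ⟨N₃, HN3⟩ := H3 _ hr (hlt hr₃ ((min_le_right _ _).trans (min_le_left _ _)))
    obtain ⟨N₄, HN4⟩ := H4 _ hr (hlt hr₄ ((min_le_right _ _).trans (min_le_right _ _)))
    refine ⟨max (max N₁ N₂) (max N₃ N₄), fun N hN => ?_⟩
    haveI := hP N
    have hA := HN4 N (le_of_max_le_right (le_of_max_le_right hN))
    have h2 : (2 : ℝ) * (η / 2) = η := by ring
    rw [← h2]
    exact ⟨hkey _ _ inferInstance inferInstance _ _
        ((((hm1 N χ hχ).comp ((Φ N).measurable_flow t)).sub measurable_const).abs) δ (η / 2)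
        (by positivity) (HN1 N (le_of_max_le_left (le_of_max_le_left hN))) hA.1,
      hkey _ _ inferInstance inferInstance _ _
        ((((hm2 N χ hχ).comp ((Φ N).measurable_flow t)).sub measurable_const).norm) δ (η / 2)
        (by positivity) (HN2 N (le_of_max_le_right (le_of_max_le_left hN))) hA.2.1,
      hkey _ _ inferInstance inferInstance _ _
        ((((hm3 N χ hχ).comp ((Φ N).measurable_flow t)).sub measurable_const).abs) δ (η / 2)
        (by positivity) (HN3 N (le_of_max_le_left (le_of_max_le_right hN))) hA.2.2⟩
  exact ⟨hlim _ _ (by positivity) fun η hη => (main η hη).imp fun N₀ h N hN => (h N hN).1,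
    hlim _ _ (by positivity) fun η hη => (main η hη).imp fun N₀ h N hN => (h N hN).2.1,
    hlim _ _ (by positivity) fun η hη => (main η hη).imp fun N₀ h N hN => (h N hN).2.2⟩

end Summit.AtomisticToContinuum.HydrodynamicLimit.Theses.BryanRoughSphereDial
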